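import Literature.GroupTheory.ArithmeticGroups.UnitaryRealApproximationCM
import Mathlib.LinearAlgebra.Matrix.GeneralLinearGroup.Defs
import HarnessLib

/-!
# Real approximation for unitary groups over a CM field: `DenseRange`, `GL` and one-place forms

Topic `GroupTheory/ArithmeticGroups`; namespace `Literature.GroupTheory.ArithmeticGroups.RealApproximationCM`.
Everything here is proved; this is the consumer-facing sequel of `UnitaryRealApproximationCM.lean`
(`unitary_realApproximation`: for a CM field `L`, `σ = IsCMField.complexConj L`, and a non-degenerate
`σ`-hermitian `H ∈ M_m(L)`, the joint archimedean image of `U(H)(L⁺) = {g : ᵗ(σg) H g = H}` is dense in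
`∏_{w ∣ ∞} U(H^w)` — Platonov–Rapinchuk Thm. 7.7 / Getz–Hahn Thm. 2.5.2 for `G = U(H)`, `S = V_∞`, proved by
Cayley's method):

* `unitaryPi L H = ∏_w U(H^w)` (closed, `isClosed_unitaryPi`), `unitarySet L H = U(H)(L⁺)` as a set of matrices
  (invertible, `det_ne_zero_of_mem_unitarySet`), `archEmb : unitarySet L H → unitaryPi L H`;
* `denseRange_archEmb` — **`DenseRange` form** of real approximation;
* `unitary_realApproximation_GL` — the closure statement with `g : GL_m(L)` (the carrier of the tree's
  `Literature.AlgebraicGeometry.ShimuraVarieties.unitaryGroup σ H ≤ GL_m(L)`, whose membership condition is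
  literally `((g : Matrix m m L).map σ)ᵀ * H * g = H`);
* `unitary_realApproximation_at` — **one complex place**: for any `φ : L →+* ℂ`, `φ(U(H)(L⁺))` is dense in
  `U(H^φ)` (projection of the joint statement; if `φ` is the conjugate of the chosen embedding of its place,
  conjugate entrywise).

Provenance: `pub-hodgecm` package file `HodgeCM/Literature/RealApproximationUnitary.lean` (pv06 gen 2, gate run 23),
section "The typed statement and its `DenseRange` forms", ported to Mathlib vocabulary; the `GL` and one-place forms
are new conveniences.

## References

* V. Platonov, A. Rapinchuk, *Algebraic Groups and Number Theory*, Academic Press 1994, §7.1 Thm. 7.7, p. 415. [PlatonovRapinchuk1994]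
* J. R. Getz, H. Hahn, *An Introduction to Automorphic Representations*, GTM 300, Springer 2024, §2.5 Def. 2.9, Thm. 2.5.2. [GetzHahn2024]
-/

noncomputable section

open Matrix NumberField NumberField.InfinitePlace Topology
open scoped ComplexConjugate

namespace Literature.GroupTheory.ArithmeticGroups.RealApproximationCM

open Literature.NumberTheory.NumberFields

variable (L : Type) [Field L] [NumberField L] [IsCMField L] {m : Type*} [Fintype m] [DecidableEq m]
  (Hm : Matrix m m L)

/-! ### `DenseRange` forms for the consumers -/

/-- `U(H)(L⁺ ⊗ ℝ) = ∏_{w : InfinitePlace L} U(H^w)` as a subset of `∏_w M_m(ℂ)`. [folklore] -/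
def unitaryPi : Set (InfinitePlace L → Matrix m m ℂ) :=
  {u | ∀ w, (u w)ᴴ * Hm.map w.embedding * u w = Hm.map w.embedding}

omit [NumberField L] [IsCMField L] [DecidableEq m] in
/-- `unitaryPi` is closed. [folklore] -/
theorem isClosed_unitaryPi : IsClosed (unitaryPi (m := m) L Hm) := by
  have : unitaryPi (m := m) L Hm =
      ⋂ w, {u : InfinitePlace L → Matrix m m ℂ | (u w)ᴴ * Hm.map w.embedding * u w = Hm.map w.embedding} := by
    ext u; simp [unitaryPi]
  rw [this]
  refine isClosed_iInter fun w => isClosed_eq ?_ continuous_const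
  have h1 : Continuous fun u : InfinitePlace L → Matrix m m ℂ => u w := continuous_apply w
  exact ((continuous_id.matrix_conjTranspose.comp h1).mul continuous_const).mul h1

/-- The `L⁺`-points `U(H)(L⁺) = {g ∈ M_m(L) : ᵗ(σg) H g = H}` as a set of matrices (for `det H ≠ 0` these are
invertible, `det_ne_zero_of_unitary`; the tree's `ShimuraVarieties.unitaryGroup σ H ≤ GL_m(L)` consists of the
same matrices). [folklore] -/
def unitarySet : Set (Matrix m m L) := {g | (g.map (IsCMField.complexConj L))ᵀ * Hm * g = Hm}

omit [DecidableEq m] in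
/-- Membership in `unitarySet`. [folklore] -/
theorem mem_unitarySet_iff (g : Matrix m m L) :
    g ∈ unitarySet (m := m) L Hm ↔ (g.map (IsCMField.complexConj L))ᵀ * Hm * g = Hm := Iff.rfl

omit [DecidableEq m] in
/-- The joint archimedean image of `U(H)(L⁺)` lies in `∏_w U(H^w)`. [folklore] -/
theorem piMap_mem_unitaryPi {g : Matrix m m L} (hg : g ∈ unitarySet (m := m) L Hm) :
    piMap L g ∈ unitaryPi (m := m) L Hm := by
  intro w
  have h2 := congrArg (fun M : Matrix m m L => M.map w.embedding) hg
  simp only [Matrix.map_mul] at h2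
  rwa [← conjTranspose_map_embedding] at h2

/-- Elements of `U(H)(L⁺)` are invertible when `det H ≠ 0` (take determinants in `ᵗ(σg) H g = H`). [folklore] -/
theorem det_ne_zero_of_mem_unitarySet (hdet : IsUnit Hm.det) {g : Matrix m m L}
    (hg : g ∈ unitarySet (m := m) L Hm) : g.det ≠ 0 := by
  intro h0
  have h := congrArg Matrix.det hg
  rw [Matrix.det_mul, Matrix.det_mul, h0, mul_zero] at h
  exact hdet.ne_zero h.symm

/-- **`GL` form** of real approximation for `U(H)`: the same closure statement with `g` ranging over
`GL_m(L)` (the carrier of the tree's `unitaryGroup σ H ≤ GL_m(L)` of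
`Literature/AlgebraicGeometry/ShimuraVarieties/UnitaryBallQuotientDatum.lean`, whose membership condition is
literally `((g : Matrix m m L).map σ)ᵀ * H * g = H`). [cite: PlatonovRapinchuk1994, §7.1 Thm 7.7] -/
theorem unitary_realApproximation_GL (hH : (Hm.map (IsCMField.complexConj L))ᵀ = Hm) (hdet : IsUnit Hm.det)
    (u : InfinitePlace L → Matrix m m ℂ) (hu : ∀ w, (u w)ᴴ * Hm.map w.embedding * u w = Hm.map w.embedding) :
    u ∈ closure {x : InfinitePlace L → Matrix m m ℂ | ∃ g : GL m L,
      (((g : Matrix m m L)).map (IsCMField.complexConj L))ᵀ * Hm * (g : Matrix m m L) = Hm ∧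
        piMap L (g : Matrix m m L) = x} := by
  refine closure_mono ?_ (unitary_realApproximation L Hm hH hdet u hu)
  rintro _ ⟨g, hg, rfl⟩
  exact ⟨Matrix.GeneralLinearGroup.mkOfDetNeZero g (det_ne_zero_of_mem_unitarySet L Hm hdet hg), hg, rfl⟩

/-- The joint archimedean embedding `U(H)(L⁺) → U(H)(L⁺ ⊗ ℝ) = ∏_w U(H^w)`. [folklore] -/
def archEmb (g : unitarySet (m := m) L Hm) : unitaryPi (m := m) L Hm :=
  ⟨piMap L (g : Matrix m m L), piMap_mem_unitaryPi L Hm g.2⟩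

/-- **Real approximation for `U(H)`, `DenseRange` form**: the archimedean embedding
`U(H)(L⁺) → ∏_{w ∣ ∞} U(H^w)` has dense range. [cite: PlatonovRapinchuk1994, §7.1 Thm 7.7] -/
theorem denseRange_archEmb (hH : (Hm.map (IsCMField.complexConj L))ᵀ = Hm) (hdet : IsUnit Hm.det) :
    DenseRange (archEmb (m := m) L Hm) := by
  rw [DenseRange, Subtype.dense_iff]
  intro u hu
  refine closure_mono ?_ (unitary_realApproximation L Hm hH hdet u hu)
  rintro _ ⟨g, hg, rfl⟩
  exact ⟨archEmb L Hm ⟨g, hg⟩, ⟨⟨g, hg⟩, rfl⟩, rfl⟩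

/-- **One-place corollary**: for a single complex embedding `φ`, the image of `U(H)(L⁺)` under `g ↦ φ(g)` is dense in
`U(H^φ) = {u : uᴴ H^φ u = H^φ}` (projection of the all-places statement to the place of `φ`, composed with complex
conjugation if `φ` is the conjugate embedding of its place). [cite: PlatonovRapinchuk1994, §7.1 Thm 7.7] -/
theorem unitary_realApproximation_at (hH : (Hm.map (IsCMField.complexConj L))ᵀ = Hm) (hdet : IsUnit Hm.det)
    (φ : L →+* ℂ) (u : Matrix m m ℂ) (hu : uᴴ * Hm.map φ * u = Hm.map φ) :
    u ∈ closure {x : Matrix m m ℂ |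
      ∃ g : Matrix m m L, (g.map (IsCMField.complexConj L))ᵀ * Hm * g = Hm ∧ g.map φ = x} := by
  classical
  rcases embedding_mk_eq φ with hφ | hφ
  · -- `φ` is the chosen embedding of its place: project the joint statement
    let uPi : InfinitePlace L → Matrix m m ℂ := fun w => if w = InfinitePlace.mk φ then u else 1
    have huPi : ∀ w, (uPi w)ᴴ * Hm.map w.embedding * uPi w = Hm.map w.embedding := by
      intro w
      by_cases h : w = InfinitePlace.mk φ
      · simp only [uPi, if_pos h]
        rw [h, hφ]
        exact hu
      · simp only [uPi, if_neg h, Matrix.conjTranspose_one, Matrix.one_mul, Matrix.mul_one]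
    have hclo := unitary_realApproximation L Hm hH hdet uPi huPi
    have hproj : Continuous fun M : InfinitePlace L → Matrix m m ℂ => M (InfinitePlace.mk φ) := continuous_apply _
    have hmem := ContinuousWithinAt.mem_closure_image hproj.continuousWithinAt hclo
    have hu1 : uPi (InfinitePlace.mk φ) = u := by simp [uPi]
    simp only [hu1] at hmem
    refine closure_mono ?_ hmem
    rintro _ ⟨x, ⟨g, hg, rfl⟩, rfl⟩
    exact ⟨g, hg, by simp only [piMap, hφ]⟩
  · -- `φ` is the conjugate of the chosen embedding of its place: conjugate entrywise
    have hφ' : ∀ x : L, φ x = starRingEnd ℂ ((InfinitePlace.mk φ).embedding x) := fun x => by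
      rw [hφ, ComplexEmbedding.conjugate_coe_eq, Complex.conj_conj]
    have hmapφ : ∀ M : Matrix m m L, M.map φ = (M.map (InfinitePlace.mk φ).embedding).map (starRingEnd ℂ) := by
      intro M; ext i j; simp [hφ']
    have hconj : ∀ A B : Matrix m m ℂ,
        (A * B).map (starRingEnd ℂ) = A.map (starRingEnd ℂ) * B.map (starRingEnd ℂ) := fun A B => Matrix.map_mul
    have hct : ∀ A : Matrix m m ℂ, (Aᴴ).map (starRingEnd ℂ) = (A.map (starRingEnd ℂ))ᴴ := by
      intro A; ext i j; simp [Matrix.conjTranspose_apply]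
    have hcc : ∀ A : Matrix m m ℂ, (A.map (starRingEnd ℂ)).map (starRingEnd ℂ) = A := by
      intro A; ext i j; simp
    have hu' : (u.map (starRingEnd ℂ))ᴴ * Hm.map (InfinitePlace.mk φ).embedding * u.map (starRingEnd ℂ) =
        Hm.map (InfinitePlace.mk φ).embedding := by
      have h := congrArg (fun M : Matrix m m ℂ => M.map (starRingEnd ℂ)) hu
      simp only [hconj, hct, hmapφ, hcc] at h
      exact h
    let uPi : InfinitePlace L → Matrix m m ℂ := fun w => if w = InfinitePlace.mk φ then u.map (starRingEnd ℂ) else 1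
    have huPi : ∀ w, (uPi w)ᴴ * Hm.map w.embedding * uPi w = Hm.map w.embedding := by
      intro w
      by_cases h : w = InfinitePlace.mk φ
      · simp only [uPi, if_pos h]
        rw [h]
        exact hu'
      · simp only [uPi, if_neg h, Matrix.conjTranspose_one, Matrix.one_mul, Matrix.mul_one]
    have hclo := unitary_realApproximation L Hm hH hdet uPi huPi
    have hproj : Continuous fun M : InfinitePlace L → Matrix m m ℂ => (M (InfinitePlace.mk φ)).map (starRingEnd ℂ) :=
      (continuous_apply _).matrix_map Complex.continuous_conj
    have hmem := ContinuousWithinAt.mem_closure_image hproj.continuousWithinAt hclo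
    have hu1 : (uPi (InfinitePlace.mk φ)).map (starRingEnd ℂ) = u := by simp [uPi, hcc]
    simp only [hu1] at hmem
    refine closure_mono ?_ hmem
    rintro _ ⟨x, ⟨g, hg, rfl⟩, rfl⟩
    exact ⟨g, hg, by simp only [piMap, hmapφ]⟩

end Literature.GroupTheory.ArithmeticGroups.RealApproximationCM

end
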